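import Summits.Ventures.CertifiedArithmetic.LowPrec.GemmEnvelopeOnset

/-!
# GEMM-level envelopes, part (x): THE OUTPUT-LEVEL ONSET OF ROW P5x IS EXACTLY `2κ_Π` (pub-lowprec gemm gen 23, LXXI-d)

HONEST FRAMING: certified error envelopes and provably optimal rounding/accumulation schemes for
low-precision formats under stated cost models; every table by two implementations; no hardware or vendor
claims.

Instances of the generic onset law of part (u) `GemmEnvelopeOnset` for row P5x (the per-vector E4M3 datapath
— ideal scale `A/448`, RNE into E4M3 — against its own pipeline constant
`C_Π = 35/289 + (γ̄ + δ̄(1 + γ̄))·324/289`).  Part (t) `row_P5x_vec_fails_pipelines` gave the witness side from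
`κ ≥ 30720`; the factor-two law of parts (j), (k), (m) (the ideal scale puts the vector maximum AT `448`, the
ceil power-of-two scale puts the block maximum in `(224, 448]`) moves every threshold of row P5 by a factor
two, and so the onset: `(2κ_Π)² = 28672²·(1 + C_Π)/((1 - γ̄)(1 - δ̄)) = 550025323610112/591583` at the caps
`(γ̄, δ̄) = (1/2048, 1/257)` (`2κ_Π ≈ 30491.83`; `2θ = 516096/17 ≈ 30358.59 < 2κ_Π < 458752/15 ≈ 30583.47`).

* `vecE4M3_ratio_band` / `vecE4M3_cell_ratio`: on `C(κ)` with `κ < 458752/15` every per-vector E4M3 element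
  is `ρ·v`, `ρ ∈ [16/17, R]`, for any `R ≥ max(18/17, κ/28672)`; cells carry `r ∈ [256/289, R²]`.
* `row_P5x_no_output_witness` (generic caps and constant) and `row_P5x_no_output_witness_below` (the
  instance `591583·κ² ≤ 550025323610112`): NO input of `C(κ)` is an output-level witness — some realisation
  has `|c - S| ≤ C_Π·L`, every `B`, `k`.
* `vecE4M3_blocked_le_ratio`: the `(0, 0)` instance — exact-accumulation per-vector E4M3 envelope
  `(R² - 1)·L` on `C(κ)`, `κ < 458752/15` (`35/289` up to `2θ`, part (j); `(κ/28672)² - 1` on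
  `[2θ, 458752/15)`), and `vecE4M3_ratio_envelope_approached`: every `q ≥ 0` with `(q + 1)·28672² < κ²` is
  exceeded (vectors `≥ 3`), so that value is the exact envelope there.
* `row_P5x_output_witness` (generic: onset `28672²(1 + C) < (1 - γ̄)(1 - δ̄)κ²`, first rung
  `225(1 + C) < 256(1 - γ̄)(1 - δ̄)`) and `row_P5x_output_onset_above` (the caps: EVERY `κ > 0` with
  `550025323610112 < 591583·κ²`): the pinned per-vector input `(448, 0, w, …)·(0, 448, w, …)`,
  `max(448/κ, 15/1024) < w`, `w² < (1 - γ̄)(1 - δ̄)/(4096(1 + C))` (`w ↦ 1/64`, numerator `448` attained) has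
  `C·L < |c - S|` for EVERY realisation.  So the output-level onset of row P5x is EXACTLY `2κ_Π` (part (t)'s
  `30720` was sufficient, not sharp).

Exact rational algebra over the kernel `roundNE`; caps are hypotheses, not device claims.  No `sorry`; axioms
`propext`, `Classical.choice`, `Quot.sound` only.  [cite: MicikeviciusEtAl2022, §3]
[cite: RouhaniEtAl2023MX, §5.1] [cite: Higham2002ASNA, §3.1]
-/

namespace Summit.Ventures.CertifiedArithmetic.LowPrec.GemmEnvelope

open Finset
open Literature.ComputerArithmetic.FloatingPoint
open Literature.ComputerArithmetic.FloatingPoint.Format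
open Literature.ComputerArithmetic.FloatingPoint.MiniFloat
open Literature.ComputerArithmetic.FloatingPoint.MXBlock
open Summit.Ventures.CertifiedArithmetic.LowPrec.SR

/-! ## The per-vector E4M3 ratio band on `C(κ)`, `κ < 458752/15` -/

/-- **PER-VECTOR E4M3 RATIO BAND** (ideal scale `A/448`, covering numerator `|v| ≤ A`, class
`v = 0 ∨ A ≤ κ|v|`, `κ < 458752/15`): the quantised element is `ρ·v` with `16/17 ≤ ρ ≤ R` for any
`R ≥ max(18/17, κ/28672)` — a normal scaled element (`≥ 1/64`) has `|ρ - 1| ≤ 1/17`, a sliver element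
(`15/1024 < 448|v|/A < 1/64`) rounds UP to `A/28672`, ratio `≤ κ/28672`. [cite: MicikeviciusEtAl2022, §3] -/
theorem vecE4M3_ratio_band {A v κ R : ℚ} (hv : |v| ≤ A) (hκ : v = 0 ∨ A ≤ κ * |v|)
    (hκM : κ < 458752 / 15) (hR : 18 / 17 ≤ R) (hκR : κ ≤ 28672 * R) :
    ∃ ρ : ℚ, 16 / 17 ≤ ρ ∧ ρ ≤ R ∧
      A / E4M3.maxRat * (roundNE E4M3 (v / (A / E4M3.maxRat))).toRat = ρ * v := by
  have hM : E4M3.maxRat = 448 := by decide +kernel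
  by_cases hv0 : v = 0
  · refine ⟨1, by norm_num, by linarith, ?_⟩
    rw [hv0, scaled_zero, mul_zero]
  have hκ' : A ≤ κ * |v| := hκ.resolve_left hv0
  have hpos : 0 < |v| := abs_pos.mpr hv0
  have hA : 0 < A := lt_of_lt_of_le hpos hv
  rw [hM]
  have hX : 0 < A / 448 := by positivity
  have h1 : κ * |v| < 458752 / 15 * |v| := mul_lt_mul_of_pos_right hκM hpos
  have h2R : κ * |v| ≤ 28672 * R * |v| := mul_le_mul_of_nonneg_right hκR hpos.le
  by_cases hn : 1 / 64 ≤ |v| / (A / 448)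
  · have h := scaled_rel_error_le E4M3 hX (by rw [e4m3_envelope_constants.2.2.2.2.1]; exact hn)
      (by rw [hM, div_le_iff₀ hX]; linarith)
    rw [e4m3_envelope_constants.1] at h
    have hρ : |A / 448 * (roundNE E4M3 (v / (A / 448))).toRat / v - 1| ≤ 1 / 17 := by
      rw [show A / 448 * (roundNE E4M3 (v / (A / 448))).toRat / v - 1
          = (A / 448 * (roundNE E4M3 (v / (A / 448))).toRat - v) / v by field_simp, abs_div,
        div_le_iff₀ hpos]
      exact h
    obtain ⟨hρ1, hρ2⟩ := abs_le.mp hρ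
    exact ⟨A / 448 * (roundNE E4M3 (v / (A / 448))).toRat / v, by linarith, by linarith,
      by rw [div_mul_cancel₀ _ hv0]⟩
  · have h2 : |v| / (A / 448) < 1 / 64 := not_le.mp hn
    have hy1 : 15 / 1024 < |v| / (A / 448) := by
      rw [lt_div_iff₀ hX]; linarith
    have hq : (roundNE E4M3 (|v| / (A / 448))).toRat = 1 / 64 := toRat_roundNE_E4M3_eq_inv64 hy1 h2.le
    have hvX : |v| < A / 448 / 64 := by rw [div_lt_iff₀ hX] at h2; linarith
    refine ⟨A / 448 / 64 / |v|, ?_, ?_, ?_⟩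
    · rw [le_div_iff₀ hpos]; linarith
    · rw [div_le_iff₀ hpos]; linarith
    · rcases lt_or_gt_of_ne hv0 with hneg | hposv
      · have e : v / (A / 448) = -(|v| / (A / 448)) := by rw [abs_of_neg hneg]; ring
        rw [e, toRat_roundNE_neg, hq, abs_of_neg hneg]
        field_simp
      · rw [abs_of_pos hposv] at hq ⊢
        rw [hq]
        field_simp

/-- The cell form of the per-vector band: `q̂a·q̂b = r·(a·b)` with `256/289 ≤ r ≤ R²`. -/
theorem vecE4M3_cell_ratio {a b Aa Ab κ R : ℚ} (ha : |a| ≤ Aa) (hca : a = 0 ∨ Aa ≤ κ * |a|)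
    (hb : |b| ≤ Ab) (hcb : b = 0 ∨ Ab ≤ κ * |b|) (hκM : κ < 458752 / 15) (hR : 18 / 17 ≤ R)
    (hκR : κ ≤ 28672 * R) :
    ∃ r : ℚ, 256 / 289 ≤ r ∧ r ≤ R ^ 2 ∧
      (Aa / E4M3.maxRat * (roundNE E4M3 (a / (Aa / E4M3.maxRat))).toRat) *
        (Ab / E4M3.maxRat * (roundNE E4M3 (b / (Ab / E4M3.maxRat))).toRat) = r * (a * b) := by
  obtain ⟨ρ, hρ1, hρ2, hρ⟩ := vecE4M3_ratio_band ha hca hκM hR hκR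
  obtain ⟨σ, hσ1, hσ2, hσ⟩ := vecE4M3_ratio_band hb hcb hκM hR hκR
  refine ⟨ρ * σ, ?_, ?_, ?_⟩
  · have := mul_le_mul hρ1 hσ1 (by norm_num) (le_trans (by norm_num) hρ1)
    linarith
  · rw [sq]; exact mul_le_mul hρ2 hσ2 (le_trans (by norm_num) hσ1) (le_trans (le_trans (by norm_num) hρ1) hρ2)
  · rw [hρ, hσ]; ring

/-! ## Row P5x: the no-witness half below the onset -/

/-- **ROW P5x, NO OUTPUT-LEVEL WITNESS (generic caps and constant)**: on `C(κ)`, `κ < 458752/15`, `18/17 ≤ R`,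
`κ ≤ 28672R`, caps `0 ≤ γ̄, δ̄ ≤ 1`, constant `C ≥ 0` with `(1 - γ̄)(1 - δ̄)R² ≤ 1 + C`,
`1 - (1 - δ̄)(1 + γ̄)·256/289 ≤ C`: EVERY input admits a realisation of the per-vector E4M3 pipeline with
`|c - S| ≤ C·L`. [cite: MicikeviciusEtAl2022, §3] [cite: Higham2002ASNA, §3.1] -/
theorem row_P5x_no_output_witness {B k : ℕ} (a b : Fin B → Fin k → ℚ) {Aa Ab κ R γ δ C : ℚ}
    (hκM : κ < 458752 / 15) (hR : 18 / 17 ≤ R) (hκR : κ ≤ 28672 * R)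
    (hC : 0 ≤ C) (hγ0 : 0 ≤ γ) (hγ1 : γ ≤ 1) (hδ0 : 0 ≤ δ) (hδ1 : δ ≤ 1)
    (hup : (1 - γ) * (1 - δ) * R ^ 2 ≤ 1 + C) (hdn : 1 - (1 - δ) * (1 + γ) * (256 / 289) ≤ C)
    (ha : ∀ j i, |a j i| ≤ Aa ∧ (a j i = 0 ∨ Aa ≤ κ * |a j i|))
    (hb : ∀ j i, |b j i| ≤ Ab ∧ (b j i = 0 ∨ Ab ≤ κ * |b j i|)) :
    ∃ acc c : ℚ,
      |acc - ∑ j, ∑ i, (Aa / E4M3.maxRat * (roundNE E4M3 (a j i / (Aa / E4M3.maxRat))).toRat) *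
          (Ab / E4M3.maxRat * (roundNE E4M3 (b j i / (Ab / E4M3.maxRat))).toRat)|
        ≤ γ * ∑ j, ∑ i, |(Aa / E4M3.maxRat * (roundNE E4M3 (a j i / (Aa / E4M3.maxRat))).toRat) *
          (Ab / E4M3.maxRat * (roundNE E4M3 (b j i / (Ab / E4M3.maxRat))).toRat)| ∧
      |c - acc| ≤ δ * |acc| ∧
      |c - ∑ j, ∑ i, a j i * b j i| ≤ C * ∑ j, ∑ i, |a j i * b j i| := by
  have key := no_output_witness_of_ratio_band (ι := Fin B × Fin k) (fun x => a x.1 x.2 * b x.1 x.2)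
    (fun x => (Aa / E4M3.maxRat * (roundNE E4M3 (a x.1 x.2 / (Aa / E4M3.maxRat))).toRat) *
      (Ab / E4M3.maxRat * (roundNE E4M3 (b x.1 x.2 / (Ab / E4M3.maxRat))).toRat))
    (rlo := 256 / 289) (rhi := R ^ 2) (γ := γ) (δ := δ) (C := C) hC hγ0 hγ1 hδ0 hδ1 (by norm_num)
    (fun x => vecE4M3_cell_ratio (ha x.1 x.2).1 (ha x.1 x.2).2 (hb x.1 x.2).1 (hb x.1 x.2).2 hκM hR hκR)
    hup hdn
  simp only [Fintype.sum_prod_type] at key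
  exact key

/-- **ROW P5x BELOW THE ONSET `2κ_Π`**: at the caps `(1/2048, 1/257)` and the constant `C_Π`, for
`591583·κ² ≤ 550025323610112` (`κ ≤ 2κ_Π ≈ 30491.83`) NO input of `C(κ)` is an output-level witness of the
per-vector E4M3 datapath against `C_Π` — some realisation has `|c - S| ≤ C_Π·L`, every `B`, `k`.  (Up to
`2θ = 516096/17` every realisation does, parts (j)/(o); the new content is the window `2θ < κ ≤ 2κ_Π`.)
[cite: MicikeviciusEtAl2022, §3] -/
theorem row_P5x_no_output_witness_below {B k : ℕ} {κ : ℚ} (hκ : 591583 * κ ^ 2 ≤ 550025323610112)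
    (a b : Fin B → Fin k → ℚ) {Aa Ab : ℚ}
    (ha : ∀ j i, |a j i| ≤ Aa ∧ (a j i = 0 ∨ Aa ≤ κ * |a j i|))
    (hb : ∀ j i, |b j i| ≤ Ab ∧ (b j i = 0 ∨ Ab ≤ κ * |b j i|)) :
    ∃ acc c : ℚ,
      |acc - ∑ j, ∑ i, (Aa / E4M3.maxRat * (roundNE E4M3 (a j i / (Aa / E4M3.maxRat))).toRat) *
          (Ab / E4M3.maxRat * (roundNE E4M3 (b j i / (Ab / E4M3.maxRat))).toRat)|
        ≤ 1 / 2048 * ∑ j, ∑ i, |(Aa / E4M3.maxRat * (roundNE E4M3 (a j i / (Aa / E4M3.maxRat))).toRat) *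
          (Ab / E4M3.maxRat * (roundNE E4M3 (b j i / (Ab / E4M3.maxRat))).toRat)| ∧
      |c - acc| ≤ 1 / 257 * |acc| ∧
      |c - ∑ j, ∑ i, a j i * b j i|
        ≤ (35 / 289 + 1 / 2048 * (324 / 289) + 1 / 257 * (324 / 289) * (1 + 1 / 2048))
          * ∑ j, ∑ i, |a j i * b j i| := by
  by_cases hθ : κ ≤ 516096 / 17
  · exact row_P5x_no_output_witness a b (R := 18 / 17) (by linarith) le_rfl (by linarith) (by norm_num)
      (by norm_num) (by norm_num) (by norm_num) (by norm_num) (by norm_num) (by norm_num) ha hb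
  · push Not at hθ
    have hκpos : 0 < κ := by linarith
    have hκM : κ < 458752 / 15 := by nlinarith
    exact row_P5x_no_output_witness a b (R := κ / 28672) hκM (by linarith) (by linarith) (by norm_num)
      (by norm_num) (by norm_num) (by norm_num) (by norm_num) (by rw [div_pow]; linarith) (by norm_num) ha hb

/-- The `(0, 0)` instance: exact-accumulation per-vector E4M3 envelope in ratio form on `C(κ)`,
`κ < 458752/15`: `|ΣΣ q̂a q̂b - S| ≤ (R² - 1)·L` for every `R ≥ max(18/17, κ/28672)`.
[cite: MicikeviciusEtAl2022, §3] -/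
theorem vecE4M3_blocked_le_ratio {B k : ℕ} (a b : Fin B → Fin k → ℚ) {Aa Ab κ R : ℚ}
    (hκM : κ < 458752 / 15) (hR : 18 / 17 ≤ R) (hκR : κ ≤ 28672 * R)
    (ha : ∀ j i, |a j i| ≤ Aa ∧ (a j i = 0 ∨ Aa ≤ κ * |a j i|))
    (hb : ∀ j i, |b j i| ≤ Ab ∧ (b j i = 0 ∨ Ab ≤ κ * |b j i|)) :
    |∑ j, ∑ i, (Aa / E4M3.maxRat * (roundNE E4M3 (a j i / (Aa / E4M3.maxRat))).toRat) *
        (Ab / E4M3.maxRat * (roundNE E4M3 (b j i / (Ab / E4M3.maxRat))).toRat)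
        - ∑ j, ∑ i, a j i * b j i| ≤ (R ^ 2 - 1) * ∑ j, ∑ i, |a j i * b j i| := by
  have hR2 : 324 / 289 ≤ R ^ 2 := by nlinarith
  obtain ⟨acc, c, hacc, hc, hS⟩ := row_P5x_no_output_witness a b (γ := 0) (δ := 0) (C := R ^ 2 - 1)
    hκM hR hκR (by linarith) le_rfl (by norm_num) le_rfl (by norm_num) (by linarith) (by norm_num; linarith)
    ha hb
  rw [zero_mul] at hacc hc
  have e1 := abs_nonpos_iff.mp hacc
  have e2 := abs_nonpos_iff.mp hc
  rw [sub_eq_zero] at e1 e2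
  rw [e2, e1] at hS
  exact hS

/-! ## Row P5x: the witness half above the onset -/

/-- **ROW P5x, OUTPUT-LEVEL WITNESS ABOVE THE ONSET (generic caps and constant)**: caps `0 ≤ γ̄ < 1`,
`0 ≤ δ̄ < 1`, `C ≥ 0`, onset `28672²(1 + C) < (1 - γ̄)(1 - δ̄)κ²` (`κ > 2κ_Π(γ̄, δ̄; C)`, `κ > 0`), first rung
`225(1 + C) < 256(1 - γ̄)(1 - δ̄)`: for vectors of length `≥ 3` the pinned per-vector input
`(448, 0, w, …)·(0, 448, w, …)`, `max(448/κ, 15/1024) < w`, `w² < (1 - γ̄)(1 - δ̄)/(4096(1 + C))` (scale `1`,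
`w ↦ 1/64`) lies in `C(κ)` and has `C·L < |c - S|` for EVERY realisation. [cite: MicikeviciusEtAl2022, §3]
[cite: Higham2002ASNA, §3.1] -/
theorem row_P5x_output_witness {B k : ℕ} (hB : 0 < B) (hk : 3 ≤ k) {κ γb δb C : ℚ} (hκ0 : 0 < κ)
    (hγb0 : 0 ≤ γb) (hγb : γb < 1) (hδb0 : 0 ≤ δb) (hδb : δb < 1) (hC : 0 ≤ C)
    (honset : 28672 ^ 2 * (1 + C) < (1 - γb) * (1 - δb) * κ ^ 2)
    (hrung : 225 * (1 + C) < 256 * ((1 - γb) * (1 - δb))) :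
    ∃ (a b : Fin B → Fin k → ℚ) (Aa Ab : ℚ),
      (∀ j i, |a j i| ≤ Aa ∧ (a j i = 0 ∨ Aa ≤ κ * |a j i|)) ∧
      (∀ j i, |b j i| ≤ Ab ∧ (b j i = 0 ∨ Ab ≤ κ * |b j i|)) ∧
      ∀ (γ δ acc c : ℚ), γ ≤ γb → δ ≤ δb →
        |acc - ∑ j, ∑ i, (Aa / E4M3.maxRat * (roundNE E4M3 (a j i / (Aa / E4M3.maxRat))).toRat) *
            (Ab / E4M3.maxRat * (roundNE E4M3 (b j i / (Ab / E4M3.maxRat))).toRat)|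
          ≤ γ * ∑ j, ∑ i, |(Aa / E4M3.maxRat * (roundNE E4M3 (a j i / (Aa / E4M3.maxRat))).toRat) *
            (Ab / E4M3.maxRat * (roundNE E4M3 (b j i / (Ab / E4M3.maxRat))).toRat)| →
        |c - acc| ≤ δ * |acc| →
        C * ∑ j, ∑ i, |a j i * b j i| < |c - ∑ j, ∑ i, a j i * b j i| := by
  obtain ⟨n, rfl⟩ : ∃ n, k = n + 3 := ⟨k - 3, by omega⟩
  have hM : E4M3.maxRat = 448 := by decide +kernel
  have hC1 : 0 < 1 + C := by linarith
  have h1γδ : 0 < (1 - γb) * (1 - δb) := mul_pos (by linarith) (by linarith)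
  set T : ℚ := (1 - γb) * (1 - δb) / (4096 * (1 + C)) with hTdef
  have hTpos : 0 < T := by rw [hTdef]; positivity
  have hT1 : T ≤ 1 / 4096 := by
    rw [hTdef, div_le_iff₀ (by positivity)]
    have : (1 - γb) * (1 - δb) ≤ 1 := by nlinarith
    linarith
  have hTC : (1 + C) * T = (1 - γb) * (1 - δb) * (1 / 64 * (1 / 64)) := by
    rw [hTdef]; field_simp; ring
  obtain ⟨m, hm0, hm448, hm15, hmT⟩ : ∃ m : ℚ, 0 < m ∧ 448 / κ ≤ m ∧ 15 / 1024 ≤ m ∧ m ^ 2 < T := by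
    by_cases h : 448 / κ ≤ 15 / 1024
    · refine ⟨15 / 1024, by norm_num, h, le_rfl, ?_⟩
      rw [hTdef, lt_div_iff₀ (by positivity)]
      linarith
    · push Not at h
      refine ⟨448 / κ, div_pos (by norm_num) hκ0, le_rfl, h.le, ?_⟩
      rw [div_pow, div_lt_iff₀ (by positivity), hTdef, div_mul_eq_mul_div, lt_div_iff₀ (by positivity)]
      linarith
  obtain ⟨w, hmw, hwT⟩ := exists_rat_gt_sq_lt hm0 hmT
  have hw0 : 0 < w := lt_trans hm0 hmw
  have hw15 : 15 / 1024 < w := lt_of_le_of_lt hm15 hmw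
  have hw16 : w ≤ 1 / 64 := by nlinarith
  have hκw : 448 ≤ κ * w := by
    have : 448 / κ < w := lt_of_le_of_lt hm448 hmw
    rw [div_lt_iff₀ hκ0, mul_comm] at this
    exact this.le
  have h64 : (roundNE E4M3 w).toRat = 1 / 64 := toRat_roundNE_E4M3_eq_inv64 hw15 hw16
  set a' : Fin (n + 3) → ℚ := Fin.cases (448 : ℚ) (Fin.cases (0 : ℚ) (fun _ : Fin (n + 1) => w)) with ha'
  set b' : Fin (n + 3) → ℚ := Fin.cases (0 : ℚ) (Fin.cases (448 : ℚ) (fun _ : Fin (n + 1) => w)) with hb'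
  obtain ⟨hca, hcb, ha0, hb1⟩ := pinned_class (n := n) hw0 (by linarith : w ≤ 448) hκw ha' hb'
  have hQ0 : (448 : ℚ) / E4M3.maxRat * (roundNE E4M3 (0 / (448 / E4M3.maxRat))).toRat = 0 := by
    rw [zero_div, toRat_roundNE_zero, mul_zero]
  obtain ⟨hS1, hS1a, hS2, hS3⟩ := pinned_sums (n := n) (A := 448) (x := w)
    (fun y : ℚ => (448 : ℚ) / E4M3.maxRat * (roundNE E4M3 (y / (448 / E4M3.maxRat))).toRat) hQ0 ha' hb'
  have hq : (448 : ℚ) / E4M3.maxRat * (roundNE E4M3 (w / (448 / E4M3.maxRat))).toRat = 1 / 64 := by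
    rw [hM, div_self (by norm_num : (448 : ℚ) ≠ 0), div_one, h64, one_mul]
  rw [hq] at hS1 hS1a
  refine ⟨fun _ => a', fun _ => b', 448, 448, fun _ i => hca i, fun _ i => hcb i, ?_⟩
  intro γ δ acc c hγ hδ hacc hc
  simp only [hS1, hS1a, hS2, hS3, sum_const, card_univ, Fintype.card_fin, nsmul_eq_mul] at hacc ⊢
  have hN : (0 : ℚ) < (B : ℚ) * ((n + 1 : ℕ) : ℚ) := by
    have : (0 : ℚ) < (B : ℚ) := by exact_mod_cast hB
    positivity
  have e1 : ((B : ℚ) * (((n + 1 : ℕ) : ℚ) * ((1 : ℚ) / 64 * (1 / 64))) : ℚ)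
      = (B : ℚ) * ((n + 1 : ℕ) : ℚ) * (1 / 64 * (1 / 64)) := by ring
  have e2 : ((B : ℚ) * (((n + 1 : ℕ) : ℚ) * |(1 : ℚ) / 64 * (1 / 64)|) : ℚ)
      = (B : ℚ) * ((n + 1 : ℕ) : ℚ) * |(1 : ℚ) / 64 * (1 / 64)| := by ring
  have e3 : ((B : ℚ) * (((n + 1 : ℕ) : ℚ) * (w * w)) : ℚ) = (B : ℚ) * ((n + 1 : ℕ) : ℚ) * (w * w) := by ring
  have e4 : ((B : ℚ) * (((n + 1 : ℕ) : ℚ) * |w * w|) : ℚ) = (B : ℚ) * ((n + 1 : ℕ) : ℚ) * |w * w| := by ring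
  rw [e1, e2] at hacc
  rw [e3, e4]
  have hnum : (C + 1) * (w * w) < (1 - γb) * (1 - δb) * (1 / 64 * (1 / 64)) := by
    rw [← hTC, ← sq, add_comm]
    exact mul_lt_mul_of_pos_left hwT hC1
  exact pipeline_witness_up_of_caps hN (by norm_num) (mul_pos hw0 hw0) hγb hδb hγ hδ hacc hc hnum

/-- **ROW P5x ABOVE THE ONSET `2κ_Π` (EVERY `κ > 2κ_Π`)**: at the caps `(1/2048, 1/257)`, for every `κ > 0` with
`550025323610112 < 591583·κ²` and vectors of length `≥ 3` an input of `C(κ)` has `C_Π·L < |c - S|` for EVERY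
realisation of the per-vector E4M3 pipeline.  With `row_P5x_no_output_witness_below`: the output-level onset
of row P5x is EXACTLY `2κ_Π` — twice the MX onset of part (v), as the factor-two law predicts.  (`0 < κ` is
necessary.) [cite: MicikeviciusEtAl2022, §3] [cite: RouhaniEtAl2023MX, §5.1] -/
theorem row_P5x_output_onset_above {B k : ℕ} (hB : 0 < B) (hk : 3 ≤ k) {κ : ℚ} (hκ0 : 0 < κ)
    (hκ : 550025323610112 < 591583 * κ ^ 2) :
    ∃ (a b : Fin B → Fin k → ℚ) (Aa Ab : ℚ),
      (∀ j i, |a j i| ≤ Aa ∧ (a j i = 0 ∨ Aa ≤ κ * |a j i|)) ∧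
      (∀ j i, |b j i| ≤ Ab ∧ (b j i = 0 ∨ Ab ≤ κ * |b j i|)) ∧
      ∀ (γ δ acc c : ℚ), γ ≤ 1 / 2048 → δ ≤ 1 / 257 →
        |acc - ∑ j, ∑ i, (Aa / E4M3.maxRat * (roundNE E4M3 (a j i / (Aa / E4M3.maxRat))).toRat) *
            (Ab / E4M3.maxRat * (roundNE E4M3 (b j i / (Ab / E4M3.maxRat))).toRat)|
          ≤ γ * ∑ j, ∑ i, |(Aa / E4M3.maxRat * (roundNE E4M3 (a j i / (Aa / E4M3.maxRat))).toRat) *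
            (Ab / E4M3.maxRat * (roundNE E4M3 (b j i / (Ab / E4M3.maxRat))).toRat)| →
        |c - acc| ≤ δ * |acc| →
        (35 / 289 + 1 / 2048 * (324 / 289) + 1 / 257 * (324 / 289) * (1 + 1 / 2048))
            * ∑ j, ∑ i, |a j i * b j i| < |c - ∑ j, ∑ i, a j i * b j i| :=
  row_P5x_output_witness hB hk hκ0 (by norm_num) (by norm_num) (by norm_num) (by norm_num) (by norm_num)
    (by linarith) (by norm_num)

/-! ## Sharpness of the exact-accumulation per-vector envelope on the sliver rung -/

/-- **THE PER-VECTOR RATIO ENVELOPE IS APPROACHED**: for `0 < κ < 458752/15`, every `q ≥ 0` with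
`(q + 1)·28672² < κ²` is exceeded on `C(κ)` (vectors `≥ 3`, exact accumulation) by the pinned input with cell
value `w`, `448/κ < w`, `w² < 1/(4096(q + 1))`.  With `vecE4M3_blocked_le_ratio`: the exact per-vector E4M3
envelope on `516096/17 ≤ κ < 458752/15` is `(κ/28672)² - 1`. [cite: MicikeviciusEtAl2022, §3] -/
theorem vecE4M3_ratio_envelope_approached {B k : ℕ} (hB : 0 < B) (hk : 3 ≤ k) {κ q : ℚ} (hκ0 : 0 < κ)
    (hκM : κ < 458752 / 15) (hq0 : 0 ≤ q) (hq : (q + 1) * 28672 ^ 2 < κ ^ 2) :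
    ∃ (a b : Fin B → Fin k → ℚ) (Aa Ab : ℚ),
      (∀ j i, |a j i| ≤ Aa ∧ (a j i = 0 ∨ Aa ≤ κ * |a j i|)) ∧
      (∀ j i, |b j i| ≤ Ab ∧ (b j i = 0 ∨ Ab ≤ κ * |b j i|)) ∧
      q * ∑ j, ∑ i, |a j i * b j i| <
        |∑ j, ∑ i, (Aa / E4M3.maxRat * (roundNE E4M3 (a j i / (Aa / E4M3.maxRat))).toRat) *
            (Ab / E4M3.maxRat * (roundNE E4M3 (b j i / (Ab / E4M3.maxRat))).toRat)
          - ∑ j, ∑ i, a j i * b j i| := by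
  obtain ⟨n, rfl⟩ : ∃ n, k = n + 3 := ⟨k - 3, by omega⟩
  have hM : E4M3.maxRat = 448 := by decide +kernel
  have hq1 : 0 < q + 1 := by linarith
  set T : ℚ := 1 / (4096 * (q + 1)) with hTdef
  have hT1 : T ≤ 1 / 4096 := by
    rw [hTdef, div_le_iff₀ (by positivity)]
    have : (1 : ℚ) ≤ q + 1 := by linarith
    nlinarith
  have hmT : (448 / κ) ^ 2 < T := by
    rw [div_pow, div_lt_iff₀ (by positivity), hTdef, div_mul_eq_mul_div, lt_div_iff₀ (by positivity)]
    linarith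
  obtain ⟨w, hmw, hwT⟩ := exists_rat_gt_sq_lt (div_pos (by norm_num) hκ0) hmT
  have hm15 : 15 / 1024 < 448 / κ := by
    rw [lt_div_iff₀ hκ0]; linarith
  have hw0 : 0 < w := lt_trans (div_pos (by norm_num) hκ0) hmw
  have hw15 : 15 / 1024 < w := lt_trans hm15 hmw
  have hw16 : w ≤ 1 / 64 := by nlinarith
  have hκw : 448 ≤ κ * w := by
    rw [div_lt_iff₀ hκ0, mul_comm] at hmw; exact hmw.le
  have h64 : (roundNE E4M3 w).toRat = 1 / 64 := toRat_roundNE_E4M3_eq_inv64 hw15 hw16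
  set a' : Fin (n + 3) → ℚ := Fin.cases (448 : ℚ) (Fin.cases (0 : ℚ) (fun _ : Fin (n + 1) => w)) with ha'
  set b' : Fin (n + 3) → ℚ := Fin.cases (0 : ℚ) (Fin.cases (448 : ℚ) (fun _ : Fin (n + 1) => w)) with hb'
  obtain ⟨hca, hcb, ha0, hb1⟩ := pinned_class (n := n) hw0 (by linarith : w ≤ 448) hκw ha' hb'
  have hQ0 : (448 : ℚ) / E4M3.maxRat * (roundNE E4M3 (0 / (448 / E4M3.maxRat))).toRat = 0 := by
    rw [zero_div, toRat_roundNE_zero, mul_zero]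
  obtain ⟨hS1, hS1a, hS2, hS3⟩ := pinned_sums (n := n) (A := 448) (x := w)
    (fun y : ℚ => (448 : ℚ) / E4M3.maxRat * (roundNE E4M3 (y / (448 / E4M3.maxRat))).toRat) hQ0 ha' hb'
  have hqv : (448 : ℚ) / E4M3.maxRat * (roundNE E4M3 (w / (448 / E4M3.maxRat))).toRat = 1 / 64 := by
    rw [hM, div_self (by norm_num : (448 : ℚ) ≠ 0), div_one, h64, one_mul]
  rw [hqv] at hS1 hS1a
  refine ⟨fun _ => a', fun _ => b', 448, 448, fun _ i => hca i, fun _ i => hcb i, ?_⟩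
  simp only [hS1, hS2, hS3, sum_const, card_univ, Fintype.card_fin, nsmul_eq_mul]
  have hN : (0 : ℚ) < (B : ℚ) * ((n + 1 : ℕ) : ℚ) := by
    have : (0 : ℚ) < (B : ℚ) := by exact_mod_cast hB
    positivity
  have e2 : ((B : ℚ) * (((n + 1 : ℕ) : ℚ) * ((1 : ℚ) / 64 * (1 / 64))) : ℚ)
      - (B : ℚ) * (((n + 1 : ℕ) : ℚ) * (w * w)) = (B : ℚ) * ((n + 1 : ℕ) : ℚ) * (1 / 64 * (1 / 64) - w * w) := by
    ring
  have e4 : ((B : ℚ) * (((n + 1 : ℕ) : ℚ) * |w * w|) : ℚ) = (B : ℚ) * ((n + 1 : ℕ) : ℚ) * (w * w) := by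
    rw [abs_of_pos (mul_pos hw0 hw0)]; ring
  rw [e2, e4]
  have hcell : q * (w * w) < 1 / 64 * (1 / 64) - w * w := by
    have h1 : (q + 1) * (w * w) < (q + 1) * T := by rw [← sq]; exact mul_lt_mul_of_pos_left hwT hq1
    have h2 : (q + 1) * T = 1 / 64 * (1 / 64) := by rw [hTdef]; field_simp; ring
    linarith
  have hpos : 0 < 1 / 64 * (1 / 64) - w * w := by nlinarith
  rw [abs_of_pos (mul_pos hN hpos)]
  have := mul_lt_mul_of_pos_left hcell hN
  linarith

end Summit.Ventures.CertifiedArithmetic.LowPrec.GemmEnvelope
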